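import Mathlib
import Summits.NavierStokesRegularity.NavierStokesRegularity.Theorems.FilamentSkeletonRssKelvinGateWeightKHeat

/-!
# Route `FilamentSkeletonRss` · crux `TransverseReduction1A` (stmt-27414; successor of the aside `TransverseReductionRJ`,
# stmt-21221) — line `kelvin_gate`: WEIGHT-`k` HEAT-KERNEL TOOLKIT II — weighted LOCAL Hölder gains of `∇e^{tΔ}`, `D²e^{tΔ}`

Helper file (theorems only, `--as helper`).  HONEST FRAMING: analysis bookkeeping for a HYPOTHETICAL filament-type rotating
self-similar blow-up route; nothing here bears on Navier–Stokes regularity; no stub is proved here.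

Continuation of `…KelvinGateWeightKHeat` (`1 ≤ k ≤ 2`, `c = 2^{n/2}`, `c′ = 1 + 2c`):

* `weight_rpow_norm_fderiv_heatExtension_le_of_local_holder` — WEIGHTED HÖLDER GRADIENT GAIN: for continuous `g` with
  `(1+|z|)^k‖g z‖ ≤ A₀` and `(1+|x|)^k‖g z − g x‖ ≤ A₁|z−x|^β` whenever `2|z−x| ≤ 1+|x|`:
  `(1+|x|)^k‖∇e^{tΔ}g(x)‖ ≤ c t^{-1/2} c′ (2t)^{β/2} A₁ + 16√2 c² c′ (4t)^{(k−1)/2} A₀`;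
* `weight_rpow_norm_fderiv_fderiv_heatExtension_le_of_local_holder` — the HESSIAN, `O(t^{-1+β/2} A₁ + t^{-1/2} A₀)` as `t → 0⁺`, by
  the semigroup split `e^{tΔ} = e^{(t/2)Δ} e^{(t/2)Δ}`;
* `weightK_heat_toolkit` — value / gradient / Hessian bounds packaged with ONE constant for heat times `t ≤ 1` (what the
  Ornstein–Uhlenbeck assembly of the free Kelvin gate on projected data consumes; design memo SHARP-WEIGHTS-DESIGN-21221-g7 §3 m3).
-/

set_option linter.dupNamespace false

noncomputable section

namespace Summit.NavierStokesRegularity.NavierStokesRegularity.Theorems.KelvinGate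

open Set Function Filter MeasureTheory Metric Real
open Literature.Analysis.UnboundedOperators
open scoped ENNReal Topology

section WeightKHolder

variable {E : Type*} [NormedAddCommGroup E] [InnerProductSpace ℝ E] [FiniteDimensional ℝ E]
  [MeasurableSpace E] [BorelSpace E]
variable {F : Type*} [NormedAddCommGroup F] [NormedSpace ℝ F] [CompleteSpace F]

/-! ## Weighted Hölder gains of the gradient and of the Hessian -/

/-- **WEIGHTED HÖLDER GRADIENT GAIN at weight `k ∈ [1, 2]`.**  Let `g` be continuous with `(1+|z|)^k ‖g(z)‖ ≤ A₀` and with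
the `⟨x⟩^k`-weighted LOCAL `β`-modulus `(1+|x|)^k ‖g(z) − g(x)‖ ≤ A₁|z − x|^β` whenever `2|z − x| ≤ 1+|x|` (`0 ≤ β ≤ 1`).  Then
`(1+|x|)^k ‖∇e^{tΔ}g(x)‖ ≤ c t^{-1/2} c′ (2t)^{β/2} A₁ + 16√2 c² c′ (4t)^{(k−1)/2} A₀` (`c = 2^{n/2}`, `c′ = 1 + 2c`):
representation `∇e^{tΔ}g(x) = ∫ ∇G_t(y) ⊗ (g(x−y) − g(x)) dy`; near increments use the weighted modulus, far increments
(`2|y| > 1+|x|`) the bound `(1+|x|)^k ≤ (2|y|)^k ≤ 4|y|·|y|^{k−1}` against the moment `∫ ‖∇G_t‖ |y| |y|^{k−1}`. -/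
theorem weight_rpow_norm_fderiv_heatExtension_le_of_local_holder {g : E → F} (hgc : Continuous g) {A₀ A₁ β k : ℝ}
    (hA₁ : 0 ≤ A₁) (hβ0 : 0 ≤ β) (hβ1 : β ≤ 1) (hk1 : 1 ≤ k) (hk2 : k ≤ 2)
    (h0 : ∀ z, (1 + ‖z‖) ^ k * ‖g z‖ ≤ A₀)
    (h1 : ∀ x z, 2 * ‖z - x‖ ≤ 1 + ‖x‖ → (1 + ‖x‖) ^ k * ‖g z - g x‖ ≤ A₁ * ‖z - x‖ ^ β)
    {t : ℝ} (ht : 0 < t) (x : E) :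
    (1 + ‖x‖) ^ k * ‖fderiv ℝ (heatExtension g t) x‖ ≤
      (2 : ℝ) ^ ((Module.finrank ℝ E : ℝ) / 2) * t ^ (-(1 / 2 : ℝ)) *
          ((1 + 2 * (2 : ℝ) ^ ((Module.finrank ℝ E : ℝ) / 2)) * (2 * t) ^ (β / 2)) * A₁ +
        8 * (2 * (2 : ℝ) ^ (1 / 2 : ℝ) * ((2 : ℝ) ^ ((Module.finrank ℝ E : ℝ) / 2)) ^ 2 *
          (1 + 2 * (2 : ℝ) ^ ((Module.finrank ℝ E : ℝ) / 2))) * (4 * t) ^ ((k - 1) / 2) * A₀ := by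
  have hk0 : 0 ≤ k := by linarith
  have hA₀ : 0 ≤ A₀ := le_trans (by positivity) (h0 0)
  have hC : ∀ z, ‖g z‖ ≤ A₀ := norm_le_of_weight_rpow_mul_norm_le hk0 h0
  have hx : 0 < (1 + ‖x‖) ^ k := by positivity
  rw [fderiv_heatExtension_eq_integral_sub_self hgc hC ht x]
  have hK1 := integrable_norm_fderiv_heatKernel (E := E) ht
  obtain ⟨hM1, -⟩ := integral_norm_fderiv_heatKernel_mul_norm_le (E := E) ht
  have hkm0 : 0 ≤ k - 1 := by linarith
  have hkm1 : k - 1 ≤ 1 := by linarith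
  obtain ⟨hMk, hMkle⟩ := integral_norm_fderiv_heatKernel_mul_norm_mul_rpow_le (E := E) ht hkm0 hkm1
  -- the `β`-moment of `‖∇G_t‖`
  have hβint : Integrable (fun y : E => ‖fderiv ℝ (heatKernel t) y‖ * ‖y‖ ^ β) := by
    refine (hK1.add hM1).mono' (((continuous_fderiv_heatKernel t).norm.mul
      (continuous_norm.rpow_const fun _ => Or.inr hβ0)).aestronglyMeasurable) (Eventually.of_forall fun y => ?_)
    rw [Real.norm_of_nonneg (mul_nonneg (norm_nonneg _) (Real.rpow_nonneg (norm_nonneg _) _))]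
    have hsplit := rpow_le_rpow_add_rpow_sub_one_mul (norm_nonneg y) one_pos hβ0 hβ1
    simp only [Real.one_rpow, one_mul] at hsplit
    calc ‖fderiv ℝ (heatKernel t) y‖ * ‖y‖ ^ β ≤ ‖fderiv ℝ (heatKernel t) y‖ * (1 + ‖y‖) :=
          mul_le_mul_of_nonneg_left hsplit (norm_nonneg _)
      _ = ‖fderiv ℝ (heatKernel t) y‖ + ‖fderiv ℝ (heatKernel t) y‖ * ‖y‖ := by ring
  -- the majorant
  have hbI : Integrable (fun y : E => ((1 + ‖x‖) ^ k)⁻¹ *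
      (A₁ * (‖fderiv ℝ (heatKernel t) y‖ * ‖y‖ ^ β) +
        8 * A₀ * (‖fderiv ℝ (heatKernel t) y‖ * ‖y‖ * ‖y‖ ^ (k - 1)))) :=
    ((hβint.const_mul A₁).add (hMk.const_mul (8 * A₀))).const_mul _
  have hb : ∀ y, ‖(fderiv ℝ (heatKernel t) y).smulRight (g (x - y) - g x)‖ ≤ ((1 + ‖x‖) ^ k)⁻¹ *
      (A₁ * (‖fderiv ℝ (heatKernel t) y‖ * ‖y‖ ^ β) +
        8 * A₀ * (‖fderiv ℝ (heatKernel t) y‖ * ‖y‖ * ‖y‖ ^ (k - 1))) := by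
    intro y
    rw [ContinuousLinearMap.norm_smulRight_apply, le_inv_mul_iff₀ hx]
    have hyk : ‖y‖ ^ k = ‖y‖ * ‖y‖ ^ (k - 1) := by
      conv_lhs => rw [show k = 1 + (k - 1) by ring]
      rw [Real.rpow_add' (norm_nonneg y) (by linarith : (1:ℝ) + (k - 1) ≠ 0), Real.rpow_one]
    have key : (1 + ‖x‖) ^ k * ‖g (x - y) - g x‖ ≤ A₁ * ‖y‖ ^ β + 8 * A₀ * (‖y‖ * ‖y‖ ^ (k - 1)) := by
      by_cases hy : 2 * ‖y‖ ≤ 1 + ‖x‖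
      · have h := h1 x (x - y) (by rwa [show x - y - x = -y by abel, norm_neg])
        rw [show x - y - x = -y by abel, norm_neg] at h
        have : 0 ≤ 8 * A₀ * (‖y‖ * ‖y‖ ^ (k - 1)) := by positivity
        linarith
      · rw [not_le] at hy
        have h2 : ‖g (x - y) - g x‖ ≤ A₀ + A₀ := (norm_sub_le _ _).trans (add_le_add (hC _) (hC _))
        have h3 : (1 + ‖x‖) ^ k ≤ 4 * (‖y‖ * ‖y‖ ^ (k - 1)) := by
          rw [← hyk]
          calc (1 + ‖x‖) ^ k ≤ (2 * ‖y‖) ^ k := Real.rpow_le_rpow (by positivity) hy.le hk0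
            _ = (2 : ℝ) ^ k * ‖y‖ ^ k := Real.mul_rpow zero_le_two (norm_nonneg _)
            _ ≤ (2 : ℝ) ^ (2 : ℝ) * ‖y‖ ^ k :=
                mul_le_mul_of_nonneg_right (Real.rpow_le_rpow_of_exponent_le one_le_two hk2)
                  (Real.rpow_nonneg (norm_nonneg _) _)
            _ = 4 * ‖y‖ ^ k := by norm_num
        have : 0 ≤ A₁ * ‖y‖ ^ β := by positivity
        calc (1 + ‖x‖) ^ k * ‖g (x - y) - g x‖ ≤ (4 * (‖y‖ * ‖y‖ ^ (k - 1))) * (A₀ + A₀) :=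
              mul_le_mul h3 h2 (norm_nonneg _) (by positivity)
          _ = 8 * A₀ * (‖y‖ * ‖y‖ ^ (k - 1)) := by ring
          _ ≤ _ := by linarith
    calc (1 + ‖x‖) ^ k * (‖fderiv ℝ (heatKernel t) y‖ * ‖g (x - y) - g x‖)
        = ‖fderiv ℝ (heatKernel t) y‖ * ((1 + ‖x‖) ^ k * ‖g (x - y) - g x‖) := by ring
      _ ≤ ‖fderiv ℝ (heatKernel t) y‖ * (A₁ * ‖y‖ ^ β + 8 * A₀ * (‖y‖ * ‖y‖ ^ (k - 1))) :=
          mul_le_mul_of_nonneg_left key (norm_nonneg _)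
      _ = _ := by ring
  calc (1 + ‖x‖) ^ k * ‖∫ y, (fderiv ℝ (heatKernel t) y).smulRight (g (x - y) - g x)‖
      ≤ (1 + ‖x‖) ^ k * ∫ y, ((1 + ‖x‖) ^ k)⁻¹ *
          (A₁ * (‖fderiv ℝ (heatKernel t) y‖ * ‖y‖ ^ β) +
            8 * A₀ * (‖fderiv ℝ (heatKernel t) y‖ * ‖y‖ * ‖y‖ ^ (k - 1))) :=
        mul_le_mul_of_nonneg_left (norm_integral_le_of_norm_le hbI (Eventually.of_forall hb)) hx.le
    _ = A₁ * (∫ y : E, ‖fderiv ℝ (heatKernel t) y‖ * ‖y‖ ^ β) +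
          8 * A₀ * ∫ y : E, ‖fderiv ℝ (heatKernel t) y‖ * ‖y‖ * ‖y‖ ^ (k - 1) := by
        rw [integral_const_mul, ← mul_assoc, mul_inv_cancel₀ hx.ne', one_mul,
          integral_add (hβint.const_mul A₁) (hMk.const_mul (8 * A₀)), integral_const_mul, integral_const_mul]
    _ ≤ A₁ * ((2 : ℝ) ^ ((Module.finrank ℝ E : ℝ) / 2) * t ^ (-(1 / 2 : ℝ)) *
          ((1 + 2 * (2 : ℝ) ^ ((Module.finrank ℝ E : ℝ) / 2)) * (2 * t) ^ (β / 2))) +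
          8 * A₀ * ((2 * (2 : ℝ) ^ (1 / 2 : ℝ) * ((2 : ℝ) ^ ((Module.finrank ℝ E : ℝ) / 2)) ^ 2 *
            (1 + 2 * (2 : ℝ) ^ ((Module.finrank ℝ E : ℝ) / 2))) * (4 * t) ^ ((k - 1) / 2)) :=
        add_le_add (mul_le_mul_of_nonneg_left (integral_norm_fderiv_heatKernel_mul_norm_rpow_le ht hβ0 hβ1) hA₁)
          (mul_le_mul_of_nonneg_left hMkle (by positivity))
    _ = _ := by ring

/-- **WEIGHTED HÖLDER GAIN OF THE HESSIAN at weight `k ∈ [1, 2]`**: under the hypotheses of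
`weight_rpow_norm_fderiv_heatExtension_le_of_local_holder`,
`(1+|x|)^k ‖D²e^{tΔ}g(x)‖ ≤ c (t/2)^{-1/2} (1 + 4c t^{1/2} + 8√2 c² t) · (c (t/2)^{-1/2} c′ t^{β/2} A₁ + 16√2 c² c′ (2t)^{(k−1)/2} A₀)` —
`O(t^{-1+β/2} A₁ + t^{-1/2} A₀)` as `t → 0⁺`: semigroup split `e^{tΔ} = e^{(t/2)Δ} e^{(t/2)Δ}`, the weighted Hölder gradient gain on
the inner factor and the weight-`k` gradient bound for continuous weighted data on the outer one. -/
theorem weight_rpow_norm_fderiv_fderiv_heatExtension_le_of_local_holder {g : E → F} (hgc : Continuous g)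
    {A₀ A₁ β k : ℝ} (hA₁ : 0 ≤ A₁) (hβ0 : 0 ≤ β) (hβ1 : β ≤ 1) (hk1 : 1 ≤ k) (hk2 : k ≤ 2)
    (h0 : ∀ z, (1 + ‖z‖) ^ k * ‖g z‖ ≤ A₀)
    (h1 : ∀ x z, 2 * ‖z - x‖ ≤ 1 + ‖x‖ → (1 + ‖x‖) ^ k * ‖g z - g x‖ ≤ A₁ * ‖z - x‖ ^ β)
    {t : ℝ} (ht : 0 < t) (x : E) :
    (1 + ‖x‖) ^ k * ‖fderiv ℝ (fderiv ℝ (heatExtension g t)) x‖ ≤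
      ((2 : ℝ) ^ ((Module.finrank ℝ E : ℝ) / 2) * (t / 2) ^ (-(1 / 2 : ℝ)) *
        (1 + 4 * (2 : ℝ) ^ ((Module.finrank ℝ E : ℝ) / 2) * t ^ (1 / 2 : ℝ) +
          8 * (2 : ℝ) ^ (1 / 2 : ℝ) * ((2 : ℝ) ^ ((Module.finrank ℝ E : ℝ) / 2)) ^ 2 * t)) *
      ((2 : ℝ) ^ ((Module.finrank ℝ E : ℝ) / 2) * (t / 2) ^ (-(1 / 2 : ℝ)) *
          ((1 + 2 * (2 : ℝ) ^ ((Module.finrank ℝ E : ℝ) / 2)) * t ^ (β / 2)) * A₁ +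
        8 * (2 * (2 : ℝ) ^ (1 / 2 : ℝ) * ((2 : ℝ) ^ ((Module.finrank ℝ E : ℝ) / 2)) ^ 2 *
          (1 + 2 * (2 : ℝ) ^ ((Module.finrank ℝ E : ℝ) / 2))) * (2 * t) ^ ((k - 1) / 2) * A₀) := by
  have hk0 : 0 ≤ k := by linarith
  have hA₀ : 0 ≤ A₀ := le_trans (by positivity) (h0 0)
  have hC : ∀ z, ‖g z‖ ≤ A₀ := norm_le_of_weight_rpow_mul_norm_le hk0 h0
  have ht2 : 0 < t / 2 := by positivity
  have hmem : MemLp g ∞ (volume : Measure E) := memLp_top_of_continuous_of_bound hgc hC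
  -- `H = e^{(t/2)Δ}g`, `e^{tΔ}g = e^{(t/2)Δ}H`
  set H : E → F := heatExtension g (t / 2) with hH
  have hsemi : heatExtension g t = heatExtension H (t / 2) := by
    rw [hH, heatExtension_add_holds hmem le_top ht2 ht2]; congr 1; ring
  have hHc : ContDiff ℝ 1 H := contDiff_heatExtension_of_bound hgc hC ht2
  have hH0 : ∀ z, ‖H z‖ ≤ A₀ := fun z => norm_heatExtension_le_of_bound hC ht2 z
  have hH1 : ∀ z, ‖fderiv ℝ H z‖ ≤ (2 : ℝ) ^ ((Module.finrank ℝ E : ℝ) / 2) * (t / 2) ^ (-(1 / 2 : ℝ)) * A₀ :=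
    fun z => norm_fderiv_heatExtension_le_of_bounded hgc.aestronglyMeasurable hC ht2 z
  have hfun : fderiv ℝ (heatExtension g t) = heatExtension (fderiv ℝ H) (t / 2) := by
    rw [hsemi]; exact funext fun z => fderiv_heatExtension_of_bounded hHc hH0 hH1 ht2 z
  rw [hfun]
  -- the inner factor: weighted Hölder gradient gain at time `t/2`
  have hDHc : Continuous (fderiv ℝ H) := hHc.continuous_fderiv one_ne_zero
  have hinner : ∀ z, (1 + ‖z‖) ^ k * ‖fderiv ℝ H z‖ ≤
      (2 : ℝ) ^ ((Module.finrank ℝ E : ℝ) / 2) * (t / 2) ^ (-(1 / 2 : ℝ)) *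
          ((1 + 2 * (2 : ℝ) ^ ((Module.finrank ℝ E : ℝ) / 2)) * t ^ (β / 2)) * A₁ +
        8 * (2 * (2 : ℝ) ^ (1 / 2 : ℝ) * ((2 : ℝ) ^ ((Module.finrank ℝ E : ℝ) / 2)) ^ 2 *
          (1 + 2 * (2 : ℝ) ^ ((Module.finrank ℝ E : ℝ) / 2))) * (2 * t) ^ ((k - 1) / 2) * A₀ := by
    intro z
    have h := weight_rpow_norm_fderiv_heatExtension_le_of_local_holder hgc hA₁ hβ0 hβ1 hk1 hk2 h0 h1 ht2 z
    rwa [show 2 * (t / 2) = t by ring, show 4 * (t / 2) = 2 * t by ring] at h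
  -- the outer factor: weight-`k` gradient bound for the continuous weighted datum `DH`
  have h := weight_rpow_norm_fderiv_heatExtension_le (f := fderiv ℝ H) hDHc hk0 hk2 hinner ht2 x
  rwa [show 2 * (t / 2) = t by ring] at h

/-! ## The toolkit packaged for heat times `t ≤ 1` -/

/-- **THE WEIGHT-`k` HEAT TOOLKIT (one constant, heat times `0 < t ≤ 1`).**  For `1 ≤ k ≤ 2` and `0 ≤ β ≤ 1` there is
`C > 0` (depending on `dim E`, `k`, `β`) such that for every continuous `g` with `(1+|z|)^k ‖g z‖ ≤ A₀` and every `t ∈ (0, 1]`: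
`(1+|x|)^k ‖e^{tΔ}g(x)‖ ≤ C A₀`, `(1+|x|)^k ‖∇e^{tΔ}g(x)‖ ≤ C t^{-1/2} A₀`, and, if moreover
`(1+|x|)^k ‖g z − g x‖ ≤ A₁ |z−x|^β` whenever `2|z−x| ≤ 1+|x|`, then `(1+|x|)^k ‖D²e^{tΔ}g(x)‖ ≤ C (t^{-1+β/2} A₁ + t^{-1/2} A₀)`. -/
theorem weightK_heat_toolkit {k β : ℝ} (hk1 : 1 ≤ k) (hk2 : k ≤ 2) (hβ0 : 0 ≤ β) (hβ1 : β ≤ 1) :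
    ∃ C : ℝ, 0 < C ∧ ∀ (g : E → F), Continuous g → ∀ (A₀ : ℝ), (∀ z, (1 + ‖z‖) ^ k * ‖g z‖ ≤ A₀) →
      ∀ ⦃t : ℝ⦄, 0 < t → t ≤ 1 →
        (∀ x, (1 + ‖x‖) ^ k * ‖heatExtension g t x‖ ≤ C * A₀) ∧
        (∀ x, (1 + ‖x‖) ^ k * ‖fderiv ℝ (heatExtension g t) x‖ ≤ C * t ^ (-(1 / 2 : ℝ)) * A₀) ∧
        ∀ (A₁ : ℝ), 0 ≤ A₁ →
          (∀ x z, 2 * ‖z - x‖ ≤ 1 + ‖x‖ → (1 + ‖x‖) ^ k * ‖g z - g x‖ ≤ A₁ * ‖z - x‖ ^ β) →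
          ∀ x, (1 + ‖x‖) ^ k * ‖fderiv ℝ (fderiv ℝ (heatExtension g t)) x‖ ≤
            C * (t ^ (-(1:ℝ) + β / 2) * A₁ + t ^ (-(1 / 2 : ℝ)) * A₀) := by
  set c : ℝ := (2 : ℝ) ^ ((Module.finrank ℝ E : ℝ) / 2) with hc
  have hc1 : 1 ≤ c := Real.one_le_rpow one_le_two (by positivity)
  have hc0 : 0 < c := by linarith
  set s : ℝ := (2 : ℝ) ^ (1 / 2 : ℝ) with hs
  have hs1 : 1 ≤ s := Real.one_le_rpow one_le_two (by norm_num)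
  have hs0 : 0 < s := by linarith
  have hs2 : s ≤ 2 := by
    calc s = (2 : ℝ) ^ (1 / 2 : ℝ) := hs
      _ ≤ (2 : ℝ) ^ (1 : ℝ) := Real.rpow_le_rpow_of_exponent_le one_le_two (by norm_num)
      _ = 2 := Real.rpow_one 2
  have hss : s * s = 2 := by rw [hs, ← Real.rpow_add two_pos]; norm_num
  set c' : ℝ := 1 + 2 * c with hc'
  have hc'1 : 1 ≤ c' := by rw [hc']; linarith
  have hc'0 : 0 < c' := by linarith
  -- `P` dominates the polynomial factors on `t ≤ 1`
  set P : ℝ := 1 + 8 * c + 16 * s * c ^ 2 with hP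
  have hP1 : 1 ≤ P := by
    have : 0 ≤ 8 * c + 16 * s * c ^ 2 := by positivity
    rw [hP]; linarith
  have hP0 : 0 < P := by linarith
  -- the constant
  set C : ℝ := 128 * c ^ 3 * c' * P with hCdef
  have hC0 : 0 < C := by positivity
  have hk0 : 0 ≤ k := by linarith
  -- `P ≤ C`, `c P ≤ C`, `2 c² c' P ≤ C`, `128 c³ c' P = C`
  have hcc : c ≤ c ^ 2 := by nlinarith
  have hcc3 : c ^ 2 ≤ c ^ 3 := by nlinarith
  have hPC : P ≤ C := by
    rw [hCdef]
    have h1 : (1:ℝ) ≤ 128 * c ^ 3 * c' := by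
      have : (1:ℝ) ≤ c ^ 3 := by nlinarith
      nlinarith
    calc P = 1 * P := (one_mul P).symm
      _ ≤ (128 * c ^ 3 * c') * P := mul_le_mul_of_nonneg_right h1 hP0.le
  have hcPC : c * P ≤ C := by
    rw [hCdef]
    have h1 : c ≤ 128 * c ^ 3 * c' := by
      have : c ≤ c ^ 3 := hcc.trans hcc3
      nlinarith
    exact mul_le_mul_of_nonneg_right h1 hP0.le
  have h2C : 2 * c ^ 2 * c' * P ≤ C := by
    rw [hCdef]
    have h1 : 2 * c ^ 2 * c' ≤ 128 * c ^ 3 * c' := by nlinarith [mul_pos (mul_pos hc0 hc0) hc'0]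
    exact mul_le_mul_of_nonneg_right h1 hP0.le
  refine ⟨C, hC0, fun g hgc A₀ h0 t ht ht1 => ?_⟩
  have hA₀ : 0 ≤ A₀ := le_trans (by positivity) (h0 0)
  -- elementary bounds on `t ≤ 1`
  have ht12 : t ^ (1 / 2 : ℝ) ≤ 1 := Real.rpow_le_one ht.le ht1 (by norm_num)
  have h2t12 : (2 * t) ^ (1 / 2 : ℝ) ≤ 2 := by
    calc (2 * t) ^ (1 / 2 : ℝ) ≤ (2 : ℝ) ^ (1 / 2 : ℝ) := Real.rpow_le_rpow (by positivity) (by linarith) (by norm_num)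
      _ ≤ 2 := hs2
  have hpoly1 : 1 + 4 * c * t ^ (1 / 2 : ℝ) + 8 * s * c ^ 2 * t ≤ P := by
    have h1 : 4 * c * t ^ (1 / 2 : ℝ) ≤ 4 * c := by
      have := mul_le_mul_of_nonneg_left ht12 (by positivity : (0:ℝ) ≤ 4 * c); linarith
    have h2 : 8 * s * c ^ 2 * t ≤ 8 * s * c ^ 2 := by
      have := mul_le_mul_of_nonneg_left ht1 (by positivity : (0:ℝ) ≤ 8 * s * c ^ 2); linarith
    have h3 : 0 ≤ 8 * s * c ^ 2 := by positivity
    rw [hP]; linarith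
  have hpoly2 : 1 + 4 * c * (2 * t) ^ (1 / 2 : ℝ) + 8 * s * c ^ 2 * (2 * t) ≤ P := by
    have h1 : 4 * c * (2 * t) ^ (1 / 2 : ℝ) ≤ 8 * c := by
      have := mul_le_mul_of_nonneg_left h2t12 (by positivity : (0:ℝ) ≤ 4 * c); linarith
    have h2 : 8 * s * c ^ 2 * (2 * t) ≤ 16 * s * c ^ 2 := by
      have := mul_le_mul_of_nonneg_left ht1 (by positivity : (0:ℝ) ≤ 16 * s * c ^ 2); linarith
    rw [hP]; linarith
  have hthalf : (t / 2) ^ (-(1 / 2 : ℝ)) = s * t ^ (-(1 / 2 : ℝ)) := by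
    have h2 : ((2:ℝ)⁻¹) ^ (-(1 / 2 : ℝ)) = s := by
      rw [Real.inv_rpow zero_le_two, Real.rpow_neg zero_le_two, inv_inv]
    rw [div_eq_mul_inv, Real.mul_rpow ht.le (by norm_num), h2, mul_comm]
  have htneg : 0 < t ^ (-(1 / 2 : ℝ)) := Real.rpow_pos_of_pos ht _
  refine ⟨fun x => ?_, fun x => ?_, fun A₁ hA₁ h1 x => ?_⟩
  · -- value
    have h := weight_rpow_norm_heatExtension_le hk0 hk2 h0 ht x
    calc _ ≤ P * A₀ := h.trans (mul_le_mul_of_nonneg_right hpoly1 hA₀)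
      _ ≤ C * A₀ := mul_le_mul_of_nonneg_right hPC hA₀
  · -- gradient
    have h := weight_rpow_norm_fderiv_heatExtension_le hgc hk0 hk2 h0 ht x
    have h' : c * t ^ (-(1 / 2 : ℝ)) * (1 + 4 * c * (2 * t) ^ (1 / 2 : ℝ) + 8 * s * c ^ 2 * (2 * t)) * A₀ ≤
        c * t ^ (-(1 / 2 : ℝ)) * P * A₀ :=
      mul_le_mul_of_nonneg_right (mul_le_mul_of_nonneg_left hpoly2 (by positivity)) hA₀
    calc _ ≤ c * t ^ (-(1 / 2 : ℝ)) * P * A₀ := h.trans h'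
      _ = (c * P) * (t ^ (-(1 / 2 : ℝ)) * A₀) := by ring
      _ ≤ C * (t ^ (-(1 / 2 : ℝ)) * A₀) := mul_le_mul_of_nonneg_right hcPC (by positivity)
      _ = _ := by ring
  · -- Hessian
    have h := weight_rpow_norm_fderiv_fderiv_heatExtension_le_of_local_holder hgc hA₁ hβ0 hβ1 hk1 hk2 h0 h1 ht x
    rw [hthalf] at h
    have hkm0 : 0 ≤ (k - 1) / 2 := by linarith
    have hkm1 : (k - 1) / 2 ≤ 1 := by linarith
    have h2tk : (2 * t) ^ ((k - 1) / 2) ≤ 4 := by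
      calc (2 * t) ^ ((k - 1) / 2) ≤ (4 : ℝ) ^ ((k - 1) / 2) := Real.rpow_le_rpow (by positivity) (by linarith) hkm0
        _ ≤ (4 : ℝ) ^ (1 : ℝ) := Real.rpow_le_rpow_of_exponent_le (by norm_num) hkm1
        _ = 4 := Real.rpow_one 4
    have htβ : 0 ≤ t ^ (β / 2) := Real.rpow_nonneg ht.le _
    -- outer factor ≤ `c s t^{-1/2} P`
    have hout : c * (s * t ^ (-(1 / 2 : ℝ))) * (1 + 4 * c * t ^ (1 / 2 : ℝ) + 8 * s * c ^ 2 * t) ≤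
        c * (s * t ^ (-(1 / 2 : ℝ))) * P :=
      mul_le_mul_of_nonneg_left hpoly1 (by positivity)
    -- inner factor ≤ `c s t^{-1/2} c′ t^{β/2} A₁ + 64 s c² c′ A₀`
    have hin2 : 8 * (2 * s * c ^ 2 * c') * (2 * t) ^ ((k - 1) / 2) * A₀ ≤ 8 * (2 * s * c ^ 2 * c') * 4 * A₀ :=
      mul_le_mul_of_nonneg_right (mul_le_mul_of_nonneg_left h2tk (by positivity)) hA₀
    have hin : c * (s * t ^ (-(1 / 2 : ℝ))) * (c' * t ^ (β / 2)) * A₁ +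
        8 * (2 * s * c ^ 2 * c') * (2 * t) ^ ((k - 1) / 2) * A₀ ≤
        c * (s * t ^ (-(1 / 2 : ℝ))) * (c' * t ^ (β / 2)) * A₁ + 8 * (2 * s * c ^ 2 * c') * 4 * A₀ :=
      add_le_add le_rfl hin2
    have hin0 : 0 ≤ c * (s * t ^ (-(1 / 2 : ℝ))) * (c' * t ^ (β / 2)) * A₁ +
        8 * (2 * s * c ^ 2 * c') * (2 * t) ^ ((k - 1) / 2) * A₀ := by positivity
    have h3 := h.trans (mul_le_mul hout hin hin0 (by positivity))
    have heq : c * (s * t ^ (-(1 / 2 : ℝ))) * P *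
        (c * (s * t ^ (-(1 / 2 : ℝ))) * (c' * t ^ (β / 2)) * A₁ + 8 * (2 * s * c ^ 2 * c') * 4 * A₀) =
        (2 * c ^ 2 * c' * P) * (t ^ (-(1:ℝ) + β / 2) * A₁) + (128 * c ^ 3 * c' * P) * (t ^ (-(1 / 2 : ℝ)) * A₀) := by
      -- rpow algebra: `t^{-1/2} t^{-1/2} t^{β/2} = t^{-1+β/2}`, `s² = 2`
      have hpow : t ^ (-(1 / 2 : ℝ)) * t ^ (-(1 / 2 : ℝ)) * t ^ (β / 2) = t ^ (-(1:ℝ) + β / 2) := by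
        rw [← Real.rpow_add ht, ← Real.rpow_add ht]; norm_num
      rw [← hpow]
      have e1 : c * (s * t ^ (-(1 / 2 : ℝ))) * P * (c * (s * t ^ (-(1 / 2 : ℝ))) * (c' * t ^ (β / 2)) * A₁) =
          (s * s) * c ^ 2 * c' * P * (t ^ (-(1 / 2 : ℝ)) * t ^ (-(1 / 2 : ℝ)) * t ^ (β / 2) * A₁) := by ring
      have e2 : c * (s * t ^ (-(1 / 2 : ℝ))) * P * (8 * (2 * s * c ^ 2 * c') * 4 * A₀) =
          64 * (s * s) * c ^ 3 * c' * P * (t ^ (-(1 / 2 : ℝ)) * A₀) := by ring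
      rw [mul_add, e1, e2, hss]; ring
    rw [heq] at h3
    refine h3.trans ?_
    have hT1 : 0 ≤ t ^ (-(1:ℝ) + β / 2) * A₁ := by positivity
    have hT2 : 0 ≤ t ^ (-(1 / 2 : ℝ)) * A₀ := by positivity
    calc (2 * c ^ 2 * c' * P) * (t ^ (-(1:ℝ) + β / 2) * A₁) + (128 * c ^ 3 * c' * P) * (t ^ (-(1 / 2 : ℝ)) * A₀)
        ≤ C * (t ^ (-(1:ℝ) + β / 2) * A₁) + C * (t ^ (-(1 / 2 : ℝ)) * A₀) :=
          add_le_add (mul_le_mul_of_nonneg_right h2C hT1) (mul_le_mul_of_nonneg_right (le_of_eq hCdef.symm) hT2)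
      _ = C * (t ^ (-(1:ℝ) + β / 2) * A₁ + t ^ (-(1 / 2 : ℝ)) * A₀) := by ring

end WeightKHolder

end Summit.NavierStokesRegularity.NavierStokesRegularity.Theorems.KelvinGate

end
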